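import Mathlib
import Summits.Ventures.HodgeRepro.OcticCMPointTruncFour
import Summits.Ventures.HodgeRepro.GaussSumEvenConductor

/-!
# OcticCMPointTruncFourAll — the conductor-`4` root numbers at `𝔭 | 5` for EVERY conjugate-dual character

Blind re-derivation cell `pub-hodge-repro`, seat night-2 (gen 5).  Target tree path
`lean/Summits/Ventures/HodgeRepro/OcticCMPointTruncFourAll.lean`.  `OcticCMPointTruncFour.lean` (gen 4, imported) evaluated
the conductor-`4` root number of ONE explicit twist on `𝒪/𝔭⁴ = k[ϖ]/(ϖ⁴)` (`k = 𝔽₅`).  With the even-conductor theorem of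
`GaussSumEvenConductor.lean` the whole family is covered:

* **The ideal of the stationary phase** `I = (ϖ²)` (`I2`): `I · I = 0`, `σ(I) ⊆ I`, membership is «the two lowest
  coefficients vanish» (`mem_I2_iff_coeff`), the `ψ̃`-annihilator of `I` is `I` (`psiAnn_I2_iff`: shifting by
  `s ϖ^{3−j}` reads off the coefficient `j ∈ {0, 1}`), and `|I| = |k|²` (`card_I2`: multiplication by `ϖ²` has kernel
  and range `I`).
* **The `σ`-fixed representative.**  `σ(a) ≡ a` mod `(ϖ²)` forces `(a)_1 = 0` (`2 ≠ 0` in `k`), so `a ≡ (a)_0` — a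
  CONSTANT — mod `I` (`sub_const_mem_I2`); constants are `σ`-fixed and have top coefficient `0`.
* **`eps_four_all`**: for EVERY conjugate-dual `ρ` of conductor exactly `4` (`ρ(1 + z) = ψ̃(a z)` on `(ϖ²)`, `a` a
  unit) with `κ |k|² = 1`, `ε(½, ρ, ψ̃) = ρ(ϖ)^n · ρ(c₀)^{−1}` where `c₀ = (a)_0 ∈ k^×` is the residue of the
  stationary point and `ρ(c₀)² = 1` — the conductor-`4` analogue of `OcticCMPointDualSign.eps_sign_of_conductor_two`
  (`ε = ω(ϖ)^n θ(β)` at `c = 2`) and of `OcticCMPointEightSign.eps_eight` (`c = 8`); for the explicit twist of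
  `OcticCMPointTruncFour` (`a = 1`) it gives back `ρ(ϖ)^n`.  `eps_four_all_p5`: `k = 𝔽₅`, `κ = 1/25`.
  `E3_four_all`: (E3) at `𝔭 | 5`, conductor `4`, for four lines trivial on the constants is the `ϖ`-part of N2.

The printed input is Kudla Prop. 3.8 (ii) / (3.32) (`book:editornd-introduction-langlands-program` p0109:L3–L11,
L33) through `PeriodCloserC7Stability.LocalChar.eps`.

**What this is not.**  The value `ρ(c₀)` for a conjugate-symplectic `ρ` (the Legendre symbol of `c₀` — the class
definition of `OcticCMPointDualSign.ConjSymplecticTame` is not transported here), odd conductors, and the four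
`χ′_j` of the face are NOT here.  Nothing here says anything about the status of the Hodge conjecture for CM abelian
varieties, which is NOT proved.
-/

set_option autoImplicit false

noncomputable section

open Polynomial Classical

namespace Summit.Ventures.HodgeRepro.PeriodCloser

open GaussSumStability

namespace TruncModel

variable {k : Type} [Field k]

/-! ### The ideal `I = (ϖ²)` of `k[ϖ]/(ϖ⁴)` -/

/-- **The ideal `I = (ϖ²) = 𝔭²/𝔭⁴`** of the stationary phase at conductor `4`. -/
def I2 : Ideal (Trunc k 4) := Ideal.span {(varpi 4 : Trunc k 4) ^ 2}

/-- `I · I = 0`. -/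
theorem I2_sq : ∀ z ∈ (I2 : Ideal (Trunc k 4)), ∀ z' ∈ (I2 : Ideal (Trunc k 4)), z * z' = 0 :=
  pow_mul_eq_zero_of_le 4 2 (by norm_num)

/-- `ϖ² · mk q = mk (X² q)`. -/
theorem varpi_sq_mul_mk (q : k[X]) : (varpi 4 : Trunc k 4) ^ 2 * mk 4 q = mk 4 (X ^ 2 * q) := by
  rw [map_mul, map_pow, AdjoinRoot.mk_X]

/-- **Membership in `I`**: the two lowest coefficients vanish. -/
theorem mem_I2_iff_coeff (x : Trunc k 4) : x ∈ I2 ↔ coeffAt 4 0 x = 0 ∧ coeffAt 4 1 x = 0 := by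
  constructor
  · intro hx
    obtain ⟨y, rfl⟩ := Ideal.mem_span_singleton.1 hx
    obtain ⟨q, rfl⟩ := AdjoinRoot.mk_surjective y
    rw [varpi_sq_mul_mk, coeffAt_mk_of_lt 4 _ (by norm_num), coeffAt_mk_of_lt 4 _ (by norm_num),
      coeff_X_pow_mul', coeff_X_pow_mul']
    simp
  · rintro ⟨h0, h1⟩
    obtain ⟨p, rfl⟩ := AdjoinRoot.mk_surjective x
    rw [coeffAt_mk_of_lt 4 p (by norm_num)] at h0 h1
    have hdvd : X ^ 2 ∣ p := X_pow_dvd_iff.2 (fun i hi => by interval_cases i <;> assumption)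
    obtain ⟨q, rfl⟩ := hdvd
    rw [I2, Ideal.mem_span_singleton]
    exact ⟨mk 4 q, (varpi_sq_mul_mk q).symm⟩

/-- `σ(I) ⊆ I`. -/
theorem conj_mem_I2 {z : Trunc k 4} (hz : z ∈ I2) : conjHom 4 z ∈ I2 := by
  obtain ⟨y, rfl⟩ := Ideal.mem_span_singleton.1 hz
  rw [I2, Ideal.mem_span_singleton, map_mul, map_pow, conjHom_varpi, neg_sq]
  exact ⟨conjHom 4 y, rfl⟩

/-- `s ϖ^j ∈ I` for `j ≥ 2`. -/
theorem mk_C_mul_X_pow_mem_I2 (s : k) {j : ℕ} (hj : 2 ≤ j) : mk 4 (C s * X ^ j) ∈ I2 := by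
  rw [I2, Ideal.mem_span_singleton]
  refine ⟨mk 4 (C s * X ^ (j - 2)), ?_⟩
  rw [varpi_sq_mul_mk]
  congr 1
  have : (X : k[X]) ^ j = X ^ 2 * X ^ (j - 2) := by rw [← pow_add, Nat.add_sub_cancel' hj]
  rw [this]
  ring

/-- **The `ψ̃`-annihilator of `I` is `I`** (`ψ₀` primitive): `ψ̃(t · s ϖ^{3−j}) = ψ₀(t_j s)` for `j ∈ {0, 1}` reads
off the two lowest coefficients of `t`. -/
theorem psiAnn_I2_iff (ψ₀ : AddChar k ℂ) (h₀ : ψ₀.IsPrimitive) (t : Trunc k 4) :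
    PsiAnn (psiTilde 4 ψ₀) I2 t ↔ t ∈ I2 := by
  constructor
  · intro ht
    obtain ⟨p, rfl, -⟩ := exists_rep 4 (by norm_num) t
    rw [mem_I2_iff_coeff, coeffAt_mk_of_lt 4 p (by norm_num), coeffAt_mk_of_lt 4 p (by norm_num)]
    have key : ∀ j, j ≤ 1 → p.coeff j = 0 := by
      intro j hj
      by_contra hne
      apply h₀ hne
      ext s
      rw [AddChar.mulShift_apply, AddChar.one_apply]
      have h := ht _ (mk_C_mul_X_pow_mem_I2 s (j := 4 - 1 - j) (by omega))
      rw [← map_mul, psiTilde_mk 4 (by norm_num), coeff_mul_C_mul_X_pow 4 p s (by omega : j ≤ 4 - 1)] at h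
      exact h
    exact ⟨key 0 (by norm_num), key 1 (by norm_num)⟩
  · intro hx z hz
    rw [I2_sq t hx z hz, AddChar.map_zero_eq_one]

/-! ### `|I| = |k|²` -/

/-- `ϖ² x = 0 ↔ x ∈ I`. -/
theorem varpi_sq_mul_eq_zero_iff (x : Trunc k 4) : (varpi 4 : Trunc k 4) ^ 2 * x = 0 ↔ x ∈ I2 := by
  constructor
  · intro h
    obtain ⟨p, rfl⟩ := AdjoinRoot.mk_surjective x
    rw [varpi_sq_mul_mk, AdjoinRoot.mk_eq_zero] at h
    rw [I2, Ideal.mem_span_singleton]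
    have h' : (X : k[X]) ^ 2 * X ^ 2 ∣ X ^ 2 * p := by rw [← pow_add]; exact h
    obtain ⟨q, hq⟩ := (mul_dvd_mul_iff_left (pow_ne_zero 2 X_ne_zero)).1 h'
    exact ⟨mk 4 q, by rw [varpi_sq_mul_mk, ← hq]⟩
  · intro hx
    obtain ⟨y, rfl⟩ := Ideal.mem_span_singleton.1 hx
    rw [← mul_assoc, ← pow_add, varpi_pow_c, zero_mul]

/-- Multiplication by `ϖ²` as an additive map. -/
def mulVarpiSq : Trunc k 4 →+ Trunc k 4 := AddMonoidHom.mulLeft ((varpi 4 : Trunc k 4) ^ 2)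

/-- The range of `ϖ² ·` is `I`. -/
theorem mulVarpiSq_range : (mulVarpiSq : Trunc k 4 →+ Trunc k 4).range = I2.toAddSubgroup := by
  ext y
  rw [AddMonoidHom.mem_range, Submodule.mem_toAddSubgroup, I2, Ideal.mem_span_singleton]
  exact ⟨fun ⟨b, hb⟩ => ⟨b, hb.symm⟩, fun ⟨b, hb⟩ => ⟨b, hb.symm⟩⟩

/-- The kernel of `ϖ² ·` is `I`. -/
theorem mulVarpiSq_ker : (mulVarpiSq : Trunc k 4 →+ Trunc k 4).ker = I2.toAddSubgroup := by
  ext y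
  rw [AddMonoidHom.mem_ker, Submodule.mem_toAddSubgroup]
  exact varpi_sq_mul_eq_zero_iff y

/-- **`|I| = |k|²`**: `|k[ϖ]/(ϖ⁴)| = |k|⁴ = |I|²`. -/
theorem card_I2 [Fintype k] : Fintype.card (I2 : Ideal (Trunc k 4)) = Fintype.card k ^ 2 := by
  have h1 := AddSubgroup.card_eq_card_quotient_mul_card_addSubgroup (mulVarpiSq : Trunc k 4 →+ Trunc k 4).ker
  have h2 : Nat.card (Trunc k 4 ⧸ (mulVarpiSq : Trunc k 4 →+ Trunc k 4).ker) =
      Nat.card (mulVarpiSq : Trunc k 4 →+ Trunc k 4).range :=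
    Nat.card_congr (QuotientAddGroup.quotientKerEquivRange mulVarpiSq).toEquiv
  rw [h2, mulVarpiSq_range, mulVarpiSq_ker] at h1
  have h3 : Nat.card (Trunc k 4) = Fintype.card k ^ 2 * Fintype.card k ^ 2 := by
    rw [Nat.card_eq_fintype_card, card_trunc, ← pow_add]
  have h4 : Nat.card (I2 : Ideal (Trunc k 4)).toAddSubgroup = Nat.card (I2 : Ideal (Trunc k 4)) :=
    Nat.card_congr (Equiv.subtypeEquivRight fun x => Submodule.mem_toAddSubgroup I2)
  rw [h4, h3] at h1
  rw [← Nat.card_eq_fintype_card]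
  exact Nat.mul_self_inj.1 h1.symm

/-! ### The `σ`-fixed representative of the stationary point -/

/-- `(σ x)_i = (−1)^i x_i` for `i < 4` (monomial by monomial). -/
theorem coeffAt_conjHom_of_lt {i : ℕ} (hi : i < 4) (x : Trunc k 4) :
    coeffAt 4 i (conjHom 4 x) = (-1) ^ i * coeffAt 4 i x := by
  induction x using AdjoinRoot.induction_on with
  | ih p =>
    induction p using Polynomial.induction_on' with
    | add p q hp hq => rw [map_add, map_add, map_add, hp, hq, map_add, mul_add]
    | monomial m a =>
      have hm : mk 4 (monomial m a) = AdjoinRoot.of (X ^ 4 : k[X]) a * varpi 4 ^ m := by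
        rw [← C_mul_X_pow_eq_monomial, map_mul, map_pow, AdjoinRoot.mk_C, AdjoinRoot.mk_X]
      have hσ : conjHom 4 (mk 4 (monomial m a)) = algebraMap k (Trunc k 4) ((-1) ^ m) * mk 4 (monomial m a) := by
        rw [hm, map_mul, map_pow, conjHom_of, conjHom_varpi, neg_pow, map_pow, map_neg, map_one]
        ring
      rw [hσ, coeffAt_algebraMap_mul, coeffAt_mk_of_lt 4 _ hi, coeff_monomial]
      by_cases hmi : m = i
      · rw [if_pos hmi, hmi]
      · rw [if_neg hmi, mul_zero, mul_zero]

/-- **`σ(a) ≡ a` mod `I` forces `a ≡ (a)_0` mod `I`** (`2 ≠ 0` in `k`): the coefficient `1` of `σ(a) − a` is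
`−2 (a)_1`. -/
theorem sub_const_mem_I2 (h2 : (2 : k) ≠ 0) (a : Trunc k 4) (h : conjHom 4 a - a ∈ I2) :
    a - algebraMap k (Trunc k 4) (coeffAt 4 0 a) ∈ I2 := by
  rw [mem_I2_iff_coeff] at h ⊢
  obtain ⟨-, h1⟩ := h
  rw [map_sub, coeffAt_conjHom_of_lt (by norm_num)] at h1
  have ha1 : coeffAt 4 1 a = 0 := by
    have : (-2 : k) * coeffAt 4 1 a = 0 := by linear_combination h1
    have h2' : (-2 : k) ≠ 0 := neg_ne_zero.2 h2
    exact (mul_eq_zero.1 this).resolve_left h2'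
  constructor
  · rw [map_sub, coeffAt_algebraMap 4 0 (by norm_num), if_pos rfl, sub_self]
  · rw [map_sub, coeffAt_algebraMap 4 1 (by norm_num), if_neg (by norm_num), sub_zero, ha1]

/-- A constant is `σ`-fixed. -/
theorem conjHom_algebraMap (r : k) : conjHom 4 (algebraMap k (Trunc k 4) r) = algebraMap k (Trunc k 4) r := by
  rw [AdjoinRoot.algebraMap_eq]
  exact conjHom_of 4 r

/-- `ψ̃` of a constant is `1` (its top coefficient is `0`). -/
theorem psiTilde_algebraMap (ψ₀ : AddChar k ℂ) (r : k) : psiTilde 4 ψ₀ (algebraMap k (Trunc k 4) r) = 1 := by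
  rw [psiTilde_apply, coeffAt_algebraMap 4 (4 - 1) (by norm_num), if_neg (by norm_num), AddChar.map_zero_eq_one]

/-! ### The conductor-`4` root number of every conjugate-dual character -/

/-- `ψ̃ ∘ σ = ψ̃ ∘ (−1 ·)` at `c = 4`. -/
theorem psiTilde_conjHom_neg (ψ₀ : AddChar k ℂ) (x : Trunc k 4) :
    psiTilde 4 ψ₀ (conjHom 4 x) = psiTilde 4 ψ₀ (-x) := by
  have := psiTilde_conj 4 (by norm_num) ψ₀ x
  rw [conj_apply] at this
  rw [this]
  congr 1
  norm_num

/-- **The conductor-`4` root number at `𝔭 | 5` of EVERY conjugate-dual character**: for `ρ` with `ρ ∘ σ = ρ⁻¹` and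
`ρ(1 + z) = ψ̃(a z)` on `I = (ϖ²)` (`a` a unit: conductor exactly `4`), with `κ |k|² = 1`:
`ε(½, ρ, ψ̃) = ρ(ϖ)^n · ρ(c₀)^{−1}`, `c₀ = (a)_0 ∈ k^×`, `ρ(c₀)² = 1`. -/
theorem eps_four_all [Fintype k] (h2 : (2 : k) ≠ 0) (ψ₀ : AddChar k ℂ) (h₀ : ψ₀.IsPrimitive) (n : ℕ)
    (ρ : LocalChar (Trunc k 4)) (hσ : ∀ x, ρ.unit (conjHom 4 x) = ρ.unit⁻¹ x) (a : (Trunc k 4)ˣ)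
    (hρ : LocalChar.Primitive (psiTilde 4 ψ₀) I2 ρ a) (κ : ℂ) (hκ : κ * (Fintype.card k : ℂ) ^ 2 = 1) :
    coeffAt 4 0 (a : Trunc k 4) ≠ 0 ∧
      ρ.unit (algebraMap k (Trunc k 4) (coeffAt 4 0 (a : Trunc k 4))) *
        ρ.unit (algebraMap k (Trunc k 4) (coeffAt 4 0 (a : Trunc k 4))) = 1 ∧
      LocalChar.eps κ n ρ (psiTilde 4 ψ₀) =
        ρ.piVal ^ n * (ρ.unit (algebraMap k (Trunc k 4) (coeffAt 4 0 (a : Trunc k 4))))⁻¹ := by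
  have hc₀ := coeffAt_zero_ne_zero_of_isUnit 4 (by norm_num) a.isUnit
  have hu : IsUnit (algebraMap k (Trunc k 4) (coeffAt 4 0 (a : Trunc k 4))) :=
    (isUnit_iff_ne_zero.2 hc₀).map (algebraMap k (Trunc k 4))
  have hconj : conjHom 4 (a : Trunc k 4) - a ∈ I2 :=
    LocalChar.conj_sub_mem (psiTilde 4 ψ₀) I2 (psiAnn_I2_iff ψ₀ h₀) (conjHom 4) (conjHom_conjHom 4)
      (fun z hz => conj_mem_I2 hz) (psiTilde_conjHom_neg ψ₀) ρ hσ a hρ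
  have hsub := sub_const_mem_I2 h2 (a : Trunc k 4) hconj
  have hκ' : κ * (Fintype.card (I2 : Ideal (Trunc k 4)) : ℂ) = 1 := by
    rw [card_I2]
    exact_mod_cast hκ
  obtain ⟨h1, hsq, -⟩ := LocalChar.eps_eq_of_conjDual κ n ρ (psiTilde 4 ψ₀) I2 I2_sq (psiAnn_I2_iff ψ₀ h₀)
    (conjHom 4) hσ (psiTilde_conjHom_neg ψ₀) a hρ hκ' hu.unit
    (by rw [IsUnit.unit_spec]; exact conjHom_algebraMap _) (by rw [IsUnit.unit_spec]; exact hsub)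
  rw [IsUnit.unit_spec] at h1 hsq
  refine ⟨hc₀, hsq, ?_⟩
  rw [h1, psiTilde_algebraMap, mul_one]

/-- The same at `k = 𝔽₅` with `κ = 1/25`. -/
theorem eps_four_all_p5 (ψ₀ : AddChar (ZMod 5) ℂ) (h₀ : ψ₀.IsPrimitive) (n : ℕ) (ρ : LocalChar (Trunc (ZMod 5) 4))
    (hσ : ∀ x, ρ.unit (conjHom 4 x) = ρ.unit⁻¹ x) (a : (Trunc (ZMod 5) 4)ˣ)
    (hρ : LocalChar.Primitive (psiTilde 4 ψ₀) I2 ρ a) :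
    coeffAt 4 0 (a : Trunc (ZMod 5) 4) ≠ 0 ∧
      ρ.unit (algebraMap (ZMod 5) (Trunc (ZMod 5) 4) (coeffAt 4 0 (a : Trunc (ZMod 5) 4))) *
        ρ.unit (algebraMap (ZMod 5) (Trunc (ZMod 5) 4) (coeffAt 4 0 (a : Trunc (ZMod 5) 4))) = 1 ∧
      LocalChar.eps ((1 / 25 : ℝ) : ℂ) n ρ (psiTilde 4 ψ₀) =
        ρ.piVal ^ n * (ρ.unit (algebraMap (ZMod 5) (Trunc (ZMod 5) 4) (coeffAt 4 0 (a : Trunc (ZMod 5) 4))))⁻¹ :=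
  eps_four_all (by decide) ψ₀ h₀ n ρ hσ a hρ _ (by rw [ZMod.card]; norm_num)

/-- **(E3) at `𝔭 | 5`, conductor `4`, for four conjugate-dual lines trivial on the constants**: the `ϖ`-part
`π₀π₁ = π₂π₃` of N2 gives `ε₀ε₁ = ε₂ε₃`. -/
theorem E3_four_all [Fintype k] (h2 : (2 : k) ≠ 0) (ψ₀ : AddChar k ℂ) (h₀ : ψ₀.IsPrimitive) (n : ℕ)
    (ρ : Fin 4 → LocalChar (Trunc k 4)) (hσ : ∀ j x, (ρ j).unit (conjHom 4 x) = (ρ j).unit⁻¹ x)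
    (hfix : ∀ j (r : k), r ≠ 0 → (ρ j).unit (algebraMap k (Trunc k 4) r) = 1) (a : Fin 4 → (Trunc k 4)ˣ)
    (hρ : ∀ j, LocalChar.Primitive (psiTilde 4 ψ₀) I2 (ρ j) (a j)) (κ : ℂ)
    (hκ : κ * (Fintype.card k : ℂ) ^ 2 = 1) (hN2 : (ρ 0).piVal * (ρ 1).piVal = (ρ 2).piVal * (ρ 3).piVal) :
    LocalChar.eps κ n (ρ 0) (psiTilde 4 ψ₀) * LocalChar.eps κ n (ρ 1) (psiTilde 4 ψ₀) =
      LocalChar.eps κ n (ρ 2) (psiTilde 4 ψ₀) * LocalChar.eps κ n (ρ 3) (psiTilde 4 ψ₀) := by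
  have h : ∀ j, LocalChar.eps κ n (ρ j) (psiTilde 4 ψ₀) = (ρ j).piVal ^ n := by
    intro j
    obtain ⟨hc₀, -, heps⟩ := eps_four_all h2 ψ₀ h₀ n (ρ j) (hσ j) (a j) (hρ j) κ hκ
    rw [heps, hfix j _ hc₀, inv_one, mul_one]
  rw [h 0, h 1, h 2, h 3, ← mul_pow, hN2, mul_pow]

end TruncModel

end Summit.Ventures.HodgeRepro.PeriodCloser

end
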